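import Summits.ResolutionOfSingularities.KangarooAtlas.MizutaniConjectureHolds
import Summits.ResolutionOfSingularities.KangarooAtlas.MizutaniAttainedGeneral
import HarnessLib

/-!
# Mizutani's conjecture — the exponent and the dimension of `B(𝔭)` as numbers; `m(e) = 2p^e − 1` as an equation

Cell topic `Summits/ResolutionOfSingularities/KangarooAtlas` (pub-rosobs); namespace
`Summit.ResolutionOfSingularities.KangarooAtlas.Mizutani`.  Part of the Lean transcription of the in-house note
MIZUTANI-PROOF-g59 (AI-written, AI-audited; *AI review is weaker than expert review*; NOT a resolution theorem, NOT
summit progress).  The tree states Mizutani's conjecture LEVEL-WISE (`MizutaniLowerBound`: "`ExponentLE 𝔭 e₀` and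
`¬ ExponentLE 𝔭 e'` for all `e' < e` ⟹ `2p^e ≤ hsDimAt 𝔭 e₀ + 1`").  This file introduces the three NUMBERS of
Mizutani's Remark 2.10 and restates the proved theorems as the single equation `m(e) = 2p^e − 1`:

* `exponent k p 𝔭` — THE EXPONENT of the Hironaka scheme `B(𝔭)` (Mizutani 1973 §1 (c): `e(B(𝔭)) := e(L_B)`, the
  least `e` with `k·F^{j−e}(L_B)_e = (L_B)_j` for all `j ≥ e`), `:= sInf {e | ExponentLE k p 𝔭 e}`; it exists for
  every `𝔭` (`exists_exponentLE`), and `exponent ≤ e ↔ ExponentLE e`, `e ≤ exponent ↔ ∀ e' < e, ¬ ExponentLE e'`;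
* `hsDim k p 𝔭` — THE DIMENSION of `B(𝔭)` (Oda p. 1168 / Mizutani Thm. 1.3), `:= hsDimAt k p 𝔭 (exponent k p 𝔭)`,
  equal to `hsDimAt k p 𝔭 e₀` at every level `e₀ ≥ exponent` (`hsDimAt_eq_hsDim`);
* `mizutaniNumber p e` — MIZUTANI'S `m(e)`: "the smallest dimension of H-schemes whose exponents are not less than
  `e`" (Remark 2.10, p. 95), the infimum of `hsDim k p 𝔭` over all fields `k` of characteristic `p` (in a fixed
  universe), all `n` and all points `𝔭` of `ℙ^n_k` with `e ≤ exponent k p 𝔭` (`hsDims p e` is that set of values);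

and proves `two_mul_pow_exponent_le` (**`dim B(𝔭) + 1 ≥ 2·p^{exponent B(𝔭)}`** for every point, from
`mizutaniLowerBound`), `isLeast_hsDims` and **`mizutaniNumber_eq : mizutaniNumber p e = 2 * p ^ e − 1`** for every
prime `p` and every `e` (from `mizutaniLowerBound` + `mizutaniAttained`), plus the field-by-field values
`GenAtt.exponent_attP = e`, `GenAtt.hsDim_attP + 1 = 2p^e` (any field with a `p`-independent pair) and
`exponent_eq_zero_of_rank_le` (`[k : k^p] ≤ p`).  Everything is relative to Oda's printed description of the
invariant additive forms taken as the definition (`Literature/…/HironakaGroupScheme.lean`).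

References: [Mizutani1973HironakaGroupSchemes] §1 (c), Thm. 1.3, Remark 2.10; [Oda1983HironakaGroupSchemeII] §2 (p. 1168).
-/

open MvPolynomial Literature.AlgebraicGeometry.Resolution Literature.AlgebraicGeometry.Resolution.HironakaScheme

namespace Summit.ResolutionOfSingularities.KangarooAtlas.Mizutani

universe u

/-! ## The exponent and the dimension of `B(𝔭)` -/

section Exponent

variable (k : Type u) [Field k] (p : ℕ) [hp : Fact p.Prime] [CharP k p] {n : ℕ}
  (𝔭 : Ideal (MvPolynomial (Fin (n + 1)) k))

/-- **The exponent of the Hironaka scheme `B(𝔭)`**: the least `e` with `exponent(L_B) ≤ e` in Oda's sense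
(`ExponentLE k p 𝔭 e`: `k·F^{j−e}(L_B)_e = (L_B)_j` for all `j ≥ e`) — Mizutani's `e(B(𝔭)) = e(L_B)`.
[cite: Mizutani1973HironakaGroupSchemes, §1 ((c): the exponent e(Q) of a graded k[F]-module, e(B) := e(U(𝔭) ∩ L)); Oda1983HironakaGroupSchemeII, §2 (p. 1168)] -/
noncomputable def exponent : ℕ := sInf {e | ExponentLE k p 𝔭 e}

/-- The exponent is attained: `ExponentLE k p 𝔭 (exponent k p 𝔭)` (a finite exponent always exists,
`exists_exponentLE`). [cite: Mizutani1973HironakaGroupSchemes, §1 (c)] -/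
theorem exponentLE_exponent : ExponentLE k p 𝔭 (exponent k p 𝔭) :=
  Nat.sInf_mem (s := {e | ExponentLE k p 𝔭 e}) (exists_exponentLE k p 𝔭)

/-- `exponent ≤ e ↔ ExponentLE e` (monotonicity of `ExponentLE`). [cite: Mizutani1973HironakaGroupSchemes, §1 (c)] -/
theorem exponent_le_iff {e : ℕ} : exponent k p 𝔭 ≤ e ↔ ExponentLE k p 𝔭 e :=
  ⟨fun h => (exponentLE_exponent k p 𝔭).mono h, fun h => Nat.sInf_le (s := {e | ExponentLE k p 𝔭 e}) h⟩

/-- `e ≤ exponent ↔ ¬ ExponentLE e'` for every `e' < e` — the tree's level-wise rendering of "exponent `≥ e`".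
[cite: Mizutani1973HironakaGroupSchemes, §1 (c) and Remark 2.10 ("whose exponents are not less than e")] -/
theorem le_exponent_iff {e : ℕ} : e ≤ exponent k p 𝔭 ↔ ∀ e', e' < e → ¬ ExponentLE k p 𝔭 e' := by
  constructor
  · intro h e' he' hE
    have := (exponent_le_iff k p 𝔭).mpr hE
    omega
  · intro h
    by_contra hlt
    exact h _ (by omega) (exponentLE_exponent k p 𝔭)

/-- `exponent = e ↔ (ExponentLE e ∧ ∀ e' < e, ¬ ExponentLE e')` ("exponent exactly `e`").
[cite: Mizutani1973HironakaGroupSchemes, §1 (c)] -/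
theorem exponent_eq_iff {e : ℕ} :
    exponent k p 𝔭 = e ↔ ExponentLE k p 𝔭 e ∧ ∀ e', e' < e → ¬ ExponentLE k p 𝔭 e' := by
  rw [le_antisymm_iff, exponent_le_iff, le_exponent_iff]

/-- **The dimension of the Hironaka scheme `B(𝔭)`**: Oda's `n + 1 − dim_k (L_B)_{e₀}` read at the exponent
(Mizutani Thm. 1.3: `dim B = dim_k (L_e / N_e)`, `e` the exponent). [cite: Oda1983HironakaGroupSchemeII, §2 (p. 1168: "The dimension of B(𝔭) equals the rank of L/L_B as a module over k[F]"); Mizutani1973HironakaGroupSchemes, Thm. 1.3] -/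
noncomputable def hsDim : ℕ := hsDimAt k p 𝔭 (exponent k p 𝔭)

/-- The dimension may be read at any level `e₀ ≥ exponent`: `hsDimAt 𝔭 e₀ = hsDim 𝔭`.
[cite: Mizutani1973HironakaGroupSchemes, Thm. 1.3] -/
theorem hsDimAt_eq_hsDim {e₀ : ℕ} (h : ExponentLE k p 𝔭 e₀) : hsDimAt k p 𝔭 e₀ = hsDim k p 𝔭 :=
  hsDimAt_eq_of_exponentLE k p 𝔭 (exponentLE_exponent k p 𝔭) ((exponent_le_iff k p 𝔭).mpr h)

/-- **`dim B(𝔭) + 1 ≥ 2·p^e` for every point `𝔭` of exponent `≥ e`** — the proved lower bound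
`mizutaniLowerBound` in the language of `exponent` / `hsDim`. [cite: Mizutani1973HironakaGroupSchemes, Remark 2.10 (m(e) ≥ 2p^e − 1, conjectured; proved in the tree as mizutaniLowerBound)] -/
theorem two_mul_pow_le_hsDim_succ (hP : IsPoint k 𝔭) {e : ℕ} (he : e ≤ exponent k p 𝔭) :
    2 * p ^ e ≤ hsDim k p 𝔭 + 1 :=
  mizutaniLowerBound p e k n 𝔭 (exponent k p 𝔭) hP (exponentLE_exponent k p 𝔭) ((le_exponent_iff k p 𝔭).mp he)

/-- **`dim B(𝔭) + 1 ≥ 2·p^{exponent B(𝔭)}` for every point `𝔭` of every `ℙ^n_k`.**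
[cite: Mizutani1973HironakaGroupSchemes, Remark 2.10] -/
theorem two_mul_pow_exponent_le (hP : IsPoint k 𝔭) : 2 * p ^ exponent k p 𝔭 ≤ hsDim k p 𝔭 + 1 :=
  two_mul_pow_le_hsDim_succ k p 𝔭 hP le_rfl

/-- Over a field with `Module.rank (k^p) k ≤ p` every point has exponent `0` (a vector group; note Cor. 10.1, last
clause). [cite: Mizutani1973HironakaGroupSchemes, Remark 1.2; in-house note MIZUTANI-PROOF-g59 Cor. 10.1] -/
theorem exponent_eq_zero_of_rank_le (hk : Module.rank (frobPow k p 1) k ≤ p) (hP : IsPoint k 𝔭) :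
    exponent k p 𝔭 = 0 :=
  Nat.le_zero.mp ((exponent_le_iff k p 𝔭).mpr (exponentLE_zero_of_rank_le k p 𝔭 hk hP))

end Exponent

/-! ## The explicit point over a field with a `p`-independent pair -/

namespace GenAtt

variable {k : Type u} [Field k] {p e : ℕ} [hp : Fact p.Prime] [CharP k p] {u : Fin 2 → k}

/-- **`exponent B(attP) = e`** over every field with a `p`-independent pair `u` (`e ≥ 1`).
[cite: Mizutani1973HironakaGroupSchemes, Remark 2.10 (e(H_e) = e)] -/
theorem exponent_attP (hu : PIndep p 1 u) (he : 1 ≤ e) : exponent k p (attP k p e u) = e := by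
  obtain ⟨e', rfl⟩ : ∃ e', e = e' + 1 := ⟨e - 1, by omega⟩
  refine (exponent_eq_iff k p _).mpr ⟨exponentLE_attP hu he, fun e'' he'' hE => ?_⟩
  exact not_exponentLE_attP hu rfl (hE.mono (by omega))

/-- **`dim B(attP) + 1 = 2p^e`** over every field with a `p`-independent pair `u` (`e ≥ 1`).
[cite: Mizutani1973HironakaGroupSchemes, Remark 2.10 (dim H_e = 2p^e − 1)] -/
theorem hsDim_attP (hu : PIndep p 1 u) (he : 1 ≤ e) : hsDim k p (attP k p e u) + 1 = 2 * p ^ e := by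
  rw [← hsDimAt_eq_hsDim k p (attP k p e u) (exponentLE_attP hu he)]
  exact hsDimAt_attP hu he

end GenAtt

/-! ## Mizutani's number `m(e)` -/

section Number

variable (p : ℕ) [hp : Fact p.Prime]

/-- The set of dimensions of the Hironaka schemes `B(𝔭)` of exponent `≥ e`: over all fields `k` of characteristic
`p` (in the universe `u`), all `n`, all points `𝔭` of `ℙ^n_k` with `e ≤ exponent B(𝔭)`.
[cite: Mizutani1973HironakaGroupSchemes, Remark 2.10 ("H-schemes whose exponents are not less than e")] -/
def hsDims (e : ℕ) : Set ℕ :=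
  {d | ∃ (k : Type u) (_ : Field k) (_ : CharP k p) (n : ℕ) (𝔭 : Ideal (MvPolynomial (Fin (n + 1)) k)),
    IsPoint k 𝔭 ∧ e ≤ exponent k p 𝔭 ∧ hsDim k p 𝔭 = d}

/-- **Mizutani's number `m(e)`**: "the smallest dimension of H-schemes whose exponents are not less than `e`"
(the infimum of `hsDims p e`; `0` if that set were empty — it never is, `pred_two_mul_pow_mem_hsDims`).
[cite: Mizutani1973HironakaGroupSchemes, Remark 2.10 (p. 95: "let m(e) be the smallest dimension of H-schemes whose exponents are not less than e")] -/
noncomputable def mizutaniNumber (e : ℕ) : ℕ := sInf (hsDims.{u} p e)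

/-- Every dimension in `hsDims p e` is `≥ 2p^e − 1` (`mizutaniLowerBound`). [cite: Mizutani1973HironakaGroupSchemes, Remark 2.10] -/
theorem pred_two_mul_pow_le_of_mem_hsDims {e d : ℕ} (hd : d ∈ hsDims.{u} p e) : 2 * p ^ e - 1 ≤ d := by
  obtain ⟨k, _, _, n, 𝔭, hP, he, rfl⟩ := hd
  have := two_mul_pow_le_hsDim_succ k p 𝔭 hP he
  omega

/-- `2p^e − 1 ∈ hsDims p e`: Mizutani's scheme `H_e` (`mizutaniAttained`; for `e = 0` a suitable vector group).
[cite: Mizutani1973HironakaGroupSchemes, Remark 2.10 (the schemes H_e with e(H_e) = e, dim H_e = 2p^e − 1)] -/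
theorem pred_two_mul_pow_mem_hsDims (e : ℕ) : 2 * p ^ e - 1 ∈ hsDims.{u} p e := by
  obtain ⟨k, _, _, n, 𝔭, hP, hE, hlt, hdim⟩ := mizutaniAttained.{u} p e
  have hexp : exponent k p 𝔭 = e := (exponent_eq_iff k p 𝔭).mpr ⟨hE, hlt⟩
  refine ⟨k, inferInstance, inferInstance, n, 𝔭, hP, hexp.ge, ?_⟩
  rw [← hsDimAt_eq_hsDim k p 𝔭 hE]
  omega

/-- `2p^e − 1` is the least element of `hsDims p e`. [cite: Mizutani1973HironakaGroupSchemes, Remark 2.10] -/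
theorem isLeast_hsDims (e : ℕ) : IsLeast (hsDims.{u} p e) (2 * p ^ e - 1) :=
  ⟨pred_two_mul_pow_mem_hsDims p e, fun _ hd => pred_two_mul_pow_le_of_mem_hsDims p hd⟩

/-- **MIZUTANI'S CONJECTURE AS AN EQUATION: `m(e) = 2p^e − 1`** for every prime `p` and every `e` (Nagoya Math. J.
52 (1973), Remark 2.10: "It is quite likely that `m(e) = 2p^e − 1`"), relative to Oda's printed description of the
invariant additive forms taken as the definition of exponent and dimension; assembled from the tree's
`mizutaniLowerBound` (encloser-2) and `mizutaniAttained` (encloser-1).  AI-written, AI-audited only; *AI review is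
weaker than expert review*; not a resolution theorem. [cite: Mizutani1973HironakaGroupSchemes, Remark 2.10] -/
theorem mizutaniNumber_eq (e : ℕ) : mizutaniNumber.{u} p e = 2 * p ^ e - 1 :=
  (isLeast_hsDims.{u} p e).csInf_eq

/-- `m(e) ≤ dim B(𝔭)` for every point `𝔭` (over a field in the universe `u`) of exponent `≥ e`.
[cite: Mizutani1973HironakaGroupSchemes, Remark 2.10] -/
theorem mizutaniNumber_le_hsDim {k : Type u} [Field k] [CharP k p] {n : ℕ}
    {𝔭 : Ideal (MvPolynomial (Fin (n + 1)) k)} (hP : IsPoint k 𝔭) {e : ℕ} (he : e ≤ exponent k p 𝔭) :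
    mizutaniNumber.{u} p e ≤ hsDim k p 𝔭 :=
  Nat.sInf_le ⟨k, inferInstance, inferInstance, n, 𝔭, hP, he, rfl⟩

/-- `m(e)` is non-decreasing in `e`. [cite: Mizutani1973HironakaGroupSchemes, Remark 2.10] -/
theorem mizutaniNumber_mono {e e' : ℕ} (h : e ≤ e') : mizutaniNumber.{u} p e ≤ mizutaniNumber.{u} p e' := by
  rw [mizutaniNumber_eq, mizutaniNumber_eq]
  have := Nat.pow_le_pow_right hp.out.pos h
  omega

end Number

end Summit.ResolutionOfSingularities.KangarooAtlas.Mizutani
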